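import Mathlib
import Literature.Analysis.OperatorTheory.Enflo2023.Basic
import Literature.Analysis.OperatorTheory.Enflo2023.Reductions
import Literature.Analysis.OperatorTheory.Enflo2023.Type2Threshold
import Literature.Analysis.OperatorTheory.Enflo2023.TypeDichotomy
import Literature.Analysis.OperatorTheory.Enflo2023.Vy
import Literature.Analysis.OperatorTheory.Enflo2023.Type2LargeL
import Literature.Analysis.InnerProduct.WeakSubsequence
import HarnessLib

/-!
# Enflo 2023, v2 p.22: (47) — "arbitrarily small `(εθ)`'s at the threshold `L₀`"

Source under adjudication: Per H. Enflo, *On the invariant subspace problem in Hilbert spaces*, arXiv:2305.15442 (v1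
2023, v2 2024), bib key `Enflo2023` — a CLAIMED proof of the invariant subspace problem for operators on a separable
Hilbert space.  This file is part of the kernel-tight typing of the manuscript by the b2b-enflo repair cell
(formaliser 2, Part B: (28)–(47), the limiting argument and the final deduction).  It records what FOLLOWS (proved
implications from the manuscript's displayed hypotheses) and, where a step does not follow, the typed inference
together with its refutation.  NOTHING here asserts that the manuscript's main theorem holds; no declaration concludes
the invariant subspace problem for an arbitrary operator.  Value (BLOCK-2b): theorems / refutations of typed
inferences about a text — not progress on the problem.

EnfloISP — Part B (formaliser 2).  v2 pp.20–22, the passage between the threshold `L₀` (`Type2LargeL.lean`) and the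
restart of the MC iteration.  The text (p.20): "there exists `L₀ > 0` such that for `L < L₀`, there exists `M(L) = M`
such that if we move `y₀ + L s_n` within distance `0.3` of `x₀` by minimal `ℓ'_n` … then `‖ℓ'_n‖₂ ≤ M` FOR ALL `n`.
But, if `L > L₀` there is no such `M`."  Then (p.22): "We now let `δ > 0`, `L < L₀` such that `|L − L₀| < δ/L`, put
`M = M(L)` and `‖ℓ_n(T)(y₀ + L s_n) − x₀‖ ≤ 0.3` and `‖ℓ_n(T)‖₂ ≤ M` for all `n`.  Then
`‖ℓ_n(T)(y₀ + L₀ s_n) − x₀‖ = ‖ℓ_n(T)(y₀ + L s_n) + (L₀ − L) s_n − x₀‖`.  Since `‖ℓ_n(T) L s_n‖ < 2`,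
`‖(L₀ − L) ℓ_n(T) s_n‖ < 2δ` and, so, `‖ℓ_n(T)(y₀ + L₀ s_n) − x₀‖ < 0.3 + 2δ`, `‖ℓ_n(T)‖₂ ≤ M`.  Now, if
`M(L₀) = ∞` then, for some `n`, `‖ℓ(T)(y₀' − L₀ s_n) − x₀‖ ≤ 0.3` may require an arbitrarily large `‖ℓ(T)‖₂`.  So,
for moving `y₀ + L₀ s_n` by minimal `ℓ(T)`'s between the distances `0.3 + δ` and `0.3` to `x₀`, may require
arbitrarily small `(εθ)`'s.  If `M(L₀) < ∞`, then for every `n`, `‖ℓ_n(T)‖₂ ≤ M(L₀)` … If the `(εθ)`'s here were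
bounded from below `(εθ)_n > 0` we could find, for some `L > L₀`, move `y₀ + L s_n` within `0.3 − δ'`, `δ' > 0`, with
a uniform bound on the `‖ℓ_n(T)‖`'s, which would be a contradiction.  So, also here we get arbitrarily small
`(εθ)`'s. (47)  Thus, we will find a sequence `y_n' = y₀' + L₀ s_n` and `δ_n > 0`, `δ_n → 0`, such that … with
`‖ℓ'_n‖₂` being inf `‖ℓ'‖₂` for `‖ℓ'(T)(y₀' + L₀ s_n) − x₀‖ ≤ 0.3` (or `≤ 0.3 + δ_n`) … `⟨y'_{n₁}, x₀ − y'_{n₁}⟩ =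
(εθ)_n` with `(εθ)_n` tending to `0`".

FINDINGS (referee items STEPS.md B15 / B18, new row B30).
1. MISSTATED as printed.  With the printed quantifier "for ALL `n`" in `M(L)` (`MovesBounded` of `Type2LargeL.lean`;
   `M(L)` read as the text itself spells it out on p.21 — "for every `n`, there exists `ℓ'_n(T)`, `‖ℓ'_n(T)‖₂ ≤ M(L)`
   such that `‖ℓ'(T)(y₀' + L s_n) − x₀‖ ≤ 0.3`", i.e. bounded moves EXIST at every index, the reading under which
   the p.21 threshold argument is valid; a reading with minimisers taken vacuously at infeasible indices would make
   `Good(L)` true whenever no index is feasible, and "no such `M` for `L > L₀`" could then not be inferred from the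
   displayed argument, which only rules out bounded moves) (47) is FALSE: a single rogue index can create the
   threshold `L₀` while the minimal moves at every other index have `(εθ)` bounded away from `0` at every radius in
   `[0.3, 0.4]`.  `printed_eq47_fails` exhibits this inside the very
   setting of the section (any strict contraction with `‖T‖ ≤ 1/10`, cf. the text's `‖T‖ = 10⁻²⁰`, any unit `x₀` and
   unit vectors `s_n ⊥ x₀` — e.g. an orthonormal, hence weakly null, sequence): for `y := 0.85 x₀` and the sequence
   `s'_0 := −4.25 x₀`, `s'_n := s_n (n ≥ 1)` the printed threshold is exactly `L₀ = 1/5` (`Good(L)` for `0 < L < 1/5`,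
   `¬Good(1/5)` because `y + L₀ s'_0 = 0`), yet every minimal move of `y + L₀ s'_n`, `n ≥ 1`, into any ball of radius
   `r ∈ [0.3, 0.4]` around `x₀` has `(εθ) ≥ 3/100`.  The failing inference is the sentence "Now, if `M(L₀) = ∞` then,
   FOR SOME `n`, … may require an arbitrarily large `‖ℓ(T)‖₂`.  So … may require arbitrarily small `(εθ)`'s": one
   index with no move at all makes `M(L₀) = ∞` and says nothing about `(εθ)` anywhere.
2. REPAIRED and CLOSED with the quantifier the sequel actually uses ("a sequence … `(εθ)_n` tending to `0`", i.e.
   behaviour as `n → ∞`): replace "for all `n`" by "for all sufficiently large `n`" (`MovesBoundedEv`).  The threshold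
   theorem of pp.20–21 survives verbatim (`type2_thresholdEv_or_NIS`: the small-`L` moves are uniform in `n`, and the
   large-`L` contradiction `largeL_ell2` only uses a tail of the sequence), and (47) becomes a theorem (`eq47`): for
   every `c > 0`, `δ > 0` there are infinitely many `n` and a radius `r ∈ [0.3, 0.3 + δ]` (`r = 0.3` in the case
   `M(L₀) < ∞`) with a minimal move `a` of `y + L₀ s_n` into the `r`-ball at `x₀` whose `(εθ) = Re⟨x₀ − V a, V a⟩`
   lies in `[0, c)`.  The proof needs ONE idea the text does not state — the scaling move: if `y' = V a` is feasible at
   radius `r` with `(εθ) = e`, then `(1 + e/2) a` reaches distance `(r² − e²/2)^{1/2} < r` (`norm_scale_sub_sq_le`) at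
   norm `≤ 2‖a‖` — plus, in the case `M(L₀) = ∞`, the text's "`‖ℓ_n(T) L s_n‖ < 2`", which is TRUE BUT ONLY
   EVENTUALLY in `n` and uniformly on `‖ℓ‖₂ ≤ M` (`eventually_L_norm_Vs_le`, from the weak nullity of `s_n` through
   the cross term `⟨V_y a, V_{s_n} a⟩ → 0`, `cross_small`); this is where the eventual quantifier is forced a second
   time.  No derivative of the value function `M(·)` and no use of (20) is needed for (47) itself.
3. `eq47_of_type2` chains `Referee.Type2` (p.7) → (20) → threshold → (47): the type-2 branch is now typed, with every
   inference closed or refuted, from the definition of type 2 up to the restart of MC on p.22; it then runs into the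
   room claim / (34)–(38) exactly as the type-1 branch does (`RoomClaim*.lean`, `not_roomClaimT`) — the verdict on the
   manuscript is unchanged.
Dictionary: paper `⟨u, v⟩` (linear in `u`) = Mathlib `⟪v, u⟫_ℂ`; `(εθ)` of a move `y' = V a` at `x₀` =
`Re⟪x₀ − y', y'⟫_ℂ` (`MinimalVector.lean`, (6)); "`‖ℓ‖₂`" = the `ℓ²` norm of the coefficient sequence (`Vy.lean`);
`y₀ = y₀' = y'_∞ =: y`.
STATUS: (47) as printed REFUTED (`printed_eq47_fails`); repaired (eventual threshold) CLOSED (zero sorry).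
-/

open scoped InnerProductSpace
open Filter Topology RCLike

namespace Literature.Analysis.OperatorTheory.Enflo2023

namespace Type2

variable {H : Type*} [NormedAddCommGroup H] [InnerProductSpace ℂ H]

/-! ### Linearity of the move `V_v a = Σ a_j T^j v` in the data vector `v` -/

/-- `V_{v+w} a = V_v a + V_w a`. [folklore] -/
lemma V_data_add [CompleteSpace H] (T : H →L[ℂ] H) (hT : ‖T‖ < 1) (v w : H) (a : Vy.ℓ2) :
    Vy.V T hT (v + w) a = Vy.V T hT v a + Vy.V T hT w a := by
  rw [Vy.V_apply, Vy.V_apply, Vy.V_apply,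
    ← (Vy.summable_terms T hT v a).tsum_add (Vy.summable_terms T hT w a)]
  refine tsum_congr fun j => ?_
  rw [map_add, smul_add]

/-- `V_{c v} a = c • V_v a`. [folklore] -/
lemma V_data_smul [CompleteSpace H] (T : H →L[ℂ] H) (hT : ‖T‖ < 1) (c : ℂ) (v : H) (a : Vy.ℓ2) :
    Vy.V T hT (c • v) a = c • Vy.V T hT v a := by
  rw [Vy.V_apply, Vy.V_apply, ← (Vy.summable_terms T hT v a).tsum_const_smul c]
  refine tsum_congr fun j => ?_
  rw [map_smul, smul_comm]

/-- `V_{v + L w} a = V_v a + L • V_w a` — the identity behind the text's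
"`ℓ_n(T)(y₀ + L₀ s_n) = ℓ_n(T)(y₀ + L s_n) + (L₀ − L) ℓ_n(T) s_n`" (v2 p.22). [cite: Enflo2023, v2 p.22] -/
lemma V_data_add_smul [CompleteSpace H] (T : H →L[ℂ] H) (hT : ‖T‖ < 1) (v w : H) (c : ℂ) (a : Vy.ℓ2) :
    Vy.V T hT (v + c • w) a = Vy.V T hT v a + c • Vy.V T hT w a := by
  rw [V_data_add, V_data_smul]

/-! ### The scaling move and the `(εθ)` of a feasible point -/

/-- **Scaling lemma.**  If `‖y'‖² ≤ q` (`q > 0`) and `e := Re⟨x₀ − y', y'⟩`, then stretching `y'` by the factor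
`1 + e/q` brings it closer to `x₀`: `‖(1 + e/q) y' − x₀‖² ≤ ‖y' − x₀‖² − e²/q`.  (Expand the square; the choice
`t = e/q` under-relaxes the exact line minimiser `t = e/‖y'‖²`.)  This is the quantitative content of "if the
`(εθ)`'s were bounded from below we could move within `0.3 − δ'`" in (47) (v2 p.22). [folklore] -/
theorem norm_scale_sub_sq_le {y' x₀ : H} {q : ℝ} (hq : 0 < q) (hy' : ‖y'‖ ^ 2 ≤ q) :
    ‖((1 + re ⟪x₀ - y', y'⟫_ℂ / q : ℝ) : ℂ) • y' - x₀‖ ^ 2 ≤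
      ‖y' - x₀‖ ^ 2 - (re ⟪x₀ - y', y'⟫_ℂ) ^ 2 / q := by
  set e : ℝ := re ⟪x₀ - y', y'⟫_ℂ with he
  have hq0 : q ≠ 0 := hq.ne'
  have h1 : ((1 + e / q : ℝ) : ℂ) • y' - x₀ = (y' - x₀) + ((e / q : ℝ) : ℂ) • y' := by
    push_cast
    rw [add_smul, one_smul]
    abel
  have h2 : ‖(y' - x₀) + ((e / q : ℝ) : ℂ) • y'‖ ^ 2 =
      ‖y' - x₀‖ ^ 2 + 2 * re ⟪y' - x₀, ((e / q : ℝ) : ℂ) • y'⟫_ℂ + ‖((e / q : ℝ) : ℂ) • y'‖ ^ 2 :=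
    @norm_add_sq ℂ _ _ _ _ _ _
  have h3 : re ⟪y' - x₀, ((e / q : ℝ) : ℂ) • y'⟫_ℂ = -(e / q * e) := by
    rw [inner_smul_right, re_ofReal_mul', show y' - x₀ = -(x₀ - y') by abel, inner_neg_left, map_neg, ← he]
    ring
  have h4 : ‖((e / q : ℝ) : ℂ) • y'‖ ^ 2 = (e / q) ^ 2 * ‖y'‖ ^ 2 := by
    rw [norm_smul, Complex.norm_real, Real.norm_eq_abs, mul_pow, sq_abs]
  rw [h1, h2, h3, h4]
  have h5 : (e / q) ^ 2 * ‖y'‖ ^ 2 ≤ (e / q) ^ 2 * q := mul_le_mul_of_nonneg_left hy' (sq_nonneg _)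
  have h6 : e / q * e = e ^ 2 / q := by
    field_simp
  have h7 : (e / q) ^ 2 * q = e ^ 2 / q := by
    field_simp
  linarith

/-- The `(εθ)` of a feasible point from below: if `‖x₀‖ = 1` and `‖x₀ − y'‖ ≤ r` then
`Re⟨x₀ − y', y'⟩ ≥ (1 − r² − ‖y'‖²)/2`. [folklore] -/
lemma etheta_ge_of_norm_sub_le {x₀ y' : H} {r : ℝ} (hx₀ : ‖x₀‖ = 1) (h : ‖x₀ - y'‖ ≤ r) :
    (1 - r ^ 2 - ‖y'‖ ^ 2) / 2 ≤ re ⟪x₀ - y', y'⟫_ℂ := by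
  have h1 : ‖x₀ - y'‖ ^ 2 = ‖x₀‖ ^ 2 - 2 * re ⟪x₀, y'⟫_ℂ + ‖y'‖ ^ 2 := @norm_sub_sq ℂ _ _ _ _ _ _
  have h2 : ‖x₀ - y'‖ ^ 2 ≤ r ^ 2 := pow_le_pow_left₀ (norm_nonneg _) h 2
  have h3 : re ⟪x₀ - y', y'⟫_ℂ = re ⟪x₀, y'⟫_ℂ - ‖y'‖ ^ 2 := by
    rw [inner_sub_left, map_sub, inner_self_eq_norm_sq]
  rw [hx₀] at h1
  rw [h3]
  nlinarith

/-- The `(εθ)` of a feasible point from above: `Re⟨x₀ − y', y'⟩ ≤ ‖x₀ − y'‖ · ‖y'‖`. [folklore] -/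
lemma etheta_le_mul {x₀ y' : H} : re ⟪x₀ - y', y'⟫_ℂ ≤ ‖x₀ - y'‖ * ‖y'‖ :=
  (re_le_norm _).trans (norm_inner_le_norm _ _)

omit [InnerProductSpace ℂ H] in
/-- A feasible point at radius `r` around a unit vector has norm `≤ 1 + r`. [folklore] -/
lemma norm_le_one_add_of_norm_sub_le {x₀ y' : H} {r : ℝ} (hx₀ : ‖x₀‖ = 1) (h : ‖x₀ - y'‖ ≤ r) :
    ‖y'‖ ≤ 1 + r := by
  calc ‖y'‖ ≤ ‖x₀‖ + ‖y' - x₀‖ := norm_le_norm_add_norm_sub' y' x₀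
    _ ≤ 1 + r := by rw [hx₀, norm_sub_rev]; exact add_le_add le_rfl h

/-! ### The repaired threshold: moves bounded for all sufficiently large `n` -/

/-- `Good_ev(L)`: the REPAIRED `Good(L)` of v2 p.20 — for some `M`, every SUFFICIENTLY LARGE `n` admits an `ℓ²` move
of norm `≤ M` of `y + L s_n` into the `0.3`-ball around `x₀` (the printed text says "for all `n`", `MovesBounded`;
see `printed_eq47_fails` for why the sequel (47) forces the eventual quantifier). [cite: Enflo2023, v2 p.20; repaired] -/
def MovesBoundedEv [CompleteSpace H] (T : H →L[ℂ] H) (hT : ‖T‖ < 1) (x₀ y : H) (s : ℕ → H) (L : ℝ) : Prop :=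
  ∃ M : ℝ, ∃ n₀ : ℕ, ∀ n, n₀ ≤ n → ∃ a : Vy.ℓ2, ‖a‖ ≤ M ∧ ‖Vy.V T hT (y + (L : ℂ) • s n) a - x₀‖ ≤ 3 / 10

/-- The printed (all-`n`) `Good(L)` implies the repaired (eventual) one. [folklore] -/
lemma movesBoundedEv_of_movesBounded [CompleteSpace H] (T : H →L[ℂ] H) (hT : ‖T‖ < 1) {x₀ y : H}
    {s : ℕ → H} {L : ℝ} (h : MovesBounded T hT x₀ y s L) : MovesBoundedEv T hT x₀ y s L := by
  obtain ⟨M, hM⟩ := h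
  exact ⟨M, 0, fun n _ => hM n⟩

/-- **Large `L` for the repaired threshold**: `largeL_ell2` applied to the tail `n ≥ n₀` of the sequence (weak
nullity and (21) pass to tails), so for `L > 7‖B‖D` not even an EVENTUAL uniform bound on the moves exists.
[cite: Enflo2023, v2 p.21] -/
theorem largeL_ell2_ev [CompleteSpace H] (T : H →L[ℂ] H) (hT : ‖T‖ < 1) {x₀ y : H} {s : ℕ → H} {D L : ℝ}
    {B : H →L[ℂ] H} (hx₀ : ‖x₀‖ = 1) (hsD : ∀ n, ‖s n‖ ≤ D)
    (hs : ∀ v : H, Tendsto (fun n => ⟪v, s n⟫_ℂ) atTop (𝓝 0))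
    (hB : ‖B y - x₀‖ ≤ 1 / 8)
    (h21 : ∀ (N : ℕ) (c : Fin (N + 1) → ℂ),
      Tendsto (fun n => ⟪B y, polyOp T N c y⟫_ℂ + ⟪B (s n), polyOp T N c (s n)⟫_ℂ) atTop (𝓝 0))
    (hL : 7 * (‖B‖ * D) < L) :
    ¬ MovesBoundedEv T hT x₀ y s L := by
  rintro ⟨M, n₀, h⟩
  have hsD' : ∀ k, ‖s (k + n₀)‖ ≤ D := fun k => hsD _
  have hs' : ∀ v : H, Tendsto (fun k => ⟪v, s (k + n₀)⟫_ℂ) atTop (𝓝 0) :=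
    fun v => (hs v).comp (tendsto_add_atTop_nat n₀)
  have h21' : ∀ (N : ℕ) (c : Fin (N + 1) → ℂ),
      Tendsto (fun k => ⟪B y, polyOp T N c y⟫_ℂ + ⟪B (s (k + n₀)), polyOp T N c (s (k + n₀))⟫_ℂ)
        atTop (𝓝 0) :=
    fun N c => (h21 N c).comp (tendsto_add_atTop_nat n₀)
  exact largeL_ell2 T hT hx₀ hsD' hs' hB h21' hL M (fun k => h (k + n₀) (Nat.le_add_left n₀ k))

/-- **The repaired threshold exists** (v2 pp.20–21 with "for all `n`" read as "for all large `n`"): verbatim the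
proof of `type2_threshold_or_NIS` — the small-`L` moves `smallL_moves` are uniform in `n`, the large-`L`
contradiction is `largeL_ell2_ev`, and `threshold_pos` supplies `L₀ > 0` with `Good_ev(L)` for `0 < L < L₀` and
`¬Good_ev(L)` for `L ≥ L₀` arbitrarily close to `L₀`. [cite: Enflo2023, v2 pp.20–21; repaired] -/
theorem type2_thresholdEv_or_NIS [CompleteSpace H] (T : H →L[ℂ] H) (hT : ‖T‖ < 1)
    (hTinj : Function.Injective (ContinuousLinearMap.adjoint T)) (m : ℕ) {x₀ y : H} {s : ℕ → H} {D : ℝ}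
    (hx₀ : ‖x₀‖ = 1) (hy : y ≠ 0) (hsD : ∀ n, ‖s n‖ ≤ D)
    (hs : ∀ v : H, Tendsto (fun n => ⟪v, s n⟫_ℂ) atTop (𝓝 0))
    (h20 : ∀ j, m ≤ j → Tendsto (fun n => ⟪y, (T ^ j) y⟫_ℂ + ⟪s n, (T ^ j) (s n)⟫_ℂ) atTop (𝓝 0)) :
    HasNontrivialClosedInvariantSubspace T ∨
      ∃ L₀ : ℝ, 0 < L₀ ∧ (∀ L, 0 < L → L < L₀ → MovesBoundedEv T hT x₀ y s L) ∧
        ∀ δ > 0, ∃ L, L₀ ≤ L ∧ L < L₀ + δ ∧ 0 < L ∧ ¬ MovesBoundedEv T hT x₀ y s L := by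
  classical
  by_cases hnc : IsNonCyclic T y
  · exact Or.inl (hasNontrivialClosedInvariantSubspace_of_isNonCyclic T hy hnc)
  have hx₀mem : x₀ ∈ orbitClosure T y := by
    have htop : orbitClosure T y = ⊤ := not_ne_iff.1 hnc
    rw [htop]; exact Submodule.mem_top
  obtain ⟨K₀, d₀, hd₀⟩ := exists_polyOp_near_of_mem_orbitClosure T y x₀ hx₀mem (by norm_num : (0 : ℝ) < 1 / 5)
  set A : H →L[ℂ] H := ContinuousLinearMap.adjoint T with hA_def
  set w : H := (A ^ m) y with hw_def
  have hw : w ≠ 0 := by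
    have hinj : Function.Injective (A ^ m) := by
      rw [ContinuousLinearMap.coe_pow']
      exact hTinj.iterate m
    intro h0
    exact hy (hinj (h0.trans (map_zero (A ^ m)).symm))
  by_cases hncA : IsNonCyclic A w
  · exact Or.inl (hasNontrivialClosedInvariantSubspace_of_adjoint T
      (hasNontrivialClosedInvariantSubspace_of_isNonCyclic A hw hncA))
  have hx₀A : x₀ ∈ orbitClosure A w := by
    have htop : orbitClosure A w = ⊤ := not_ne_iff.1 hncA
    rw [htop]; exact Submodule.mem_top
  obtain ⟨K, d, hd⟩ := exists_polyOp_near_of_mem_orbitClosure A w x₀ hx₀A (by norm_num : (0 : ℝ) < 1 / 8)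
  have hB : ‖testOp T m K d y - x₀‖ ≤ 1 / 8 := by rw [testOp_apply]; exact hd
  right
  have hD : 0 ≤ D := (norm_nonneg _).trans (hsD 0)
  have hQD : 0 ≤ ‖polyOp T K₀ d₀‖ * D := mul_nonneg (norm_nonneg _) hD
  have hBD : 0 ≤ ‖testOp T m K d‖ * D := mul_nonneg (norm_nonneg _) hD
  obtain ⟨ε, hε_def⟩ : ∃ ε : ℝ, ε = 1 / (10 * (‖polyOp T K₀ d₀‖ * D + 1)) := ⟨_, rfl⟩
  have h10 : (0 : ℝ) < 10 * (‖polyOp T K₀ d₀‖ * D + 1) := by linarith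
  have hε : 0 < ε := by rw [hε_def]; exact div_pos one_pos h10
  refine threshold_pos (MovesBoundedEv T hT x₀ y s) ε hε (fun L hL0 hLε => ?_)
    (7 * (‖testOp T m K d‖ * D) + 1) (by linarith) ?_
  · refine ⟨‖coeffSeq K₀ d₀‖, 0, fun n _ => smallL_moves T hT hsD hd₀ hL0.le ?_ n⟩
    have h1 : L * (‖polyOp T K₀ d₀‖ * D) ≤ ε * (‖polyOp T K₀ d₀‖ * D) := mul_le_mul_of_nonneg_right hLε.le hQD
    have h2 : ε * (‖polyOp T K₀ d₀‖ * D + 1) = 1 / 10 := by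
      rw [hε_def, div_mul_eq_mul_div, one_mul, div_eq_iff h10.ne']
      ring
    have h3 : ε * (‖polyOp T K₀ d₀‖ * D) ≤ ε * (‖polyOp T K₀ d₀‖ * D + 1) :=
      mul_le_mul_of_nonneg_left (by linarith) hε.le
    linarith
  · exact largeL_ell2_ev T hT hx₀ hsD hs hB (fun N c => eq21_of_eq20 T m h20 K d N c) (by linarith)

/-! ### The cross term `⟨V_y a, V_{s_n} a⟩ → 0`, uniformly on `‖a‖ ≤ M` -/

/-- **Cross term.**  For `s_n ⇀ 0` bounded and `‖T‖ < 1`: `sup_{‖a‖ ≤ M} |⟨V_y a, V_{s_n} a⟩| → 0`.  Truncate both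
moves at degree `N` (`V_trunc`; tails `≤ ‖T‖^{N+1}‖v‖(1 − ‖T‖²)^{-1/2}‖a‖`, `norm_V_tail_le`) and use
`⟨T^i y, T^j s_n⟩ → 0` for the finitely many `i, j ≤ N`.  This is the precise form of the text's "Since
`‖ℓ_n(T) L s_n‖ < 2`" on p.22, which holds only in the limit `n → ∞`. [cite: Enflo2023, v2 p.22; folklore] -/
theorem cross_small [CompleteSpace H] (T : H →L[ℂ] H) (hT : ‖T‖ < 1) (y : H) {s : ℕ → H} {D : ℝ}
    (hsD : ∀ n, ‖s n‖ ≤ D) (hs : ∀ v : H, Tendsto (fun n => ⟪v, s n⟫_ℂ) atTop (𝓝 0))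
    (M : ℝ) {η : ℝ} (hη : 0 < η) :
    ∀ᶠ n in atTop, ∀ a : Vy.ℓ2, ‖a‖ ≤ M → ‖⟪Vy.V T hT y a, Vy.V T hT (s n) a⟫_ℂ‖ ≤ η := by
  by_cases hM : 0 ≤ M
  swap
  · exact Eventually.of_forall fun n a ha => absurd ((norm_nonneg a).trans ha) hM
  have hD : 0 ≤ D := (norm_nonneg _).trans (hsD 0)
  have hT0 : 0 ≤ ‖T‖ := norm_nonneg _
  set κ : ℝ := Real.sqrt (1 / (1 - ‖T‖ ^ 2)) with hκ_def
  have hκ : 0 ≤ κ := Real.sqrt_nonneg _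
  have hyκ : 0 ≤ ‖y‖ * κ := mul_nonneg (norm_nonneg _) hκ
  have hDκ : 0 ≤ D * κ := mul_nonneg hD hκ
  -- the truncation degree `N`: tails contribute `≤ η/2`
  set Cst : ℝ := 3 * κ ^ 2 * ‖y‖ * D * M ^ 2 + 1 with hCst
  have hCst1 : 0 ≤ 3 * κ ^ 2 * ‖y‖ * D * M ^ 2 :=
    mul_nonneg (mul_nonneg (mul_nonneg (mul_nonneg (by norm_num) (sq_nonneg _)) (norm_nonneg _)) hD)
      (sq_nonneg _)
  have hCst0 : 0 < Cst := by rw [hCst]; linarith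
  obtain ⟨N, hN⟩ := exists_pow_lt_of_lt_one (div_pos (half_pos hη) hCst0) hT
  have hN' : ‖T‖ ^ (N + 1) * Cst ≤ η / 2 := by
    have h1 : ‖T‖ ^ (N + 1) ≤ ‖T‖ ^ N := pow_le_pow_of_le_one hT0 hT.le (Nat.le_succ N)
    have h2 : ‖T‖ ^ (N + 1) * Cst ≤ ‖T‖ ^ N * Cst := mul_le_mul_of_nonneg_right h1 hCst0.le
    have h3 : ‖T‖ ^ N * Cst ≤ η / 2 / Cst * Cst := mul_le_mul_of_nonneg_right hN.le hCst0.le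
    rw [div_mul_cancel₀ _ hCst0.ne'] at h3
    linarith
  have hTN : 0 ≤ ‖T‖ ^ (N + 1) := pow_nonneg hT0 _
  have hT1 : ‖T‖ ^ (N + 1) ≤ 1 := pow_le_one₀ hT0 hT.le
  -- the finite part tends to `0`
  set F : ℕ → ℝ := fun n => ∑ i ∈ Finset.range (N + 1), ∑ j ∈ Finset.range (N + 1),
      ‖⟪(T ^ i) y, (T ^ j) (s n)⟫_ℂ‖ with hF
  have hF0 : Tendsto F atTop (𝓝 0) := by
    have h0 : (0 : ℝ) = ∑ i ∈ Finset.range (N + 1), ∑ j ∈ Finset.range (N + 1), (0 : ℝ) := by simp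
    rw [h0]
    refine tendsto_finsetSum _ fun i _ => tendsto_finsetSum _ fun j _ => ?_
    have h := (tendsto_inner_apply_of_weakNull (T ^ j) s hs ((T ^ i) y)).norm
    rwa [norm_zero] at h
  have hpos : 0 < η / 2 / (M ^ 2 + 1) := div_pos (half_pos hη) (by positivity)
  have hFev : ∀ᶠ n in atTop, F n ≤ η / 2 / (M ^ 2 + 1) := hF0.eventually (Iic_mem_nhds hpos)
  filter_upwards [hFev] with n hn
  intro a ha
  have hai : ∀ i, ‖a i‖ ≤ M := fun i => (lp.norm_apply_le_norm two_ne_zero a i).trans ha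
  -- truncations and tails
  set Wy := Vy.V T hT y with hWy
  set Ws := Vy.V T hT (s n) with hWs
  set Ry : H := (T ^ (N + 1)) (Wy ((Vy.L ^ (N + 1)) a)) with hRy
  set Rs : H := (T ^ (N + 1)) (Ws ((Vy.L ^ (N + 1)) a)) with hRs
  set Py : H := ∑ j ∈ Finset.range (N + 1), a j • (T ^ j) y with hPy
  set Ps : H := ∑ j ∈ Finset.range (N + 1), a j • (T ^ j) (s n) with hPs
  have hdy : Wy a = Py + Ry := V_trunc T hT y a N
  have hds : Ws a = Ps + Rs := V_trunc T hT (s n) a N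
  have hRy_le : ‖Ry‖ ≤ ‖T‖ ^ (N + 1) * (‖y‖ * κ) * M :=
    (norm_V_tail_le T hT y a N).trans (mul_le_mul_of_nonneg_left ha (mul_nonneg hTN hyκ))
  have hRs_le : ‖Rs‖ ≤ ‖T‖ ^ (N + 1) * (D * κ) * M := by
    calc ‖Rs‖ ≤ ‖T‖ ^ (N + 1) * (‖s n‖ * κ) * ‖a‖ := norm_V_tail_le T hT (s n) a N
      _ ≤ ‖T‖ ^ (N + 1) * (D * κ) * M :=
          mul_le_mul (mul_le_mul_of_nonneg_left (mul_le_mul_of_nonneg_right (hsD n) hκ) hTN) ha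
            (norm_nonneg _) (mul_nonneg hTN hDκ)
  have hWya : ‖Wy a‖ ≤ ‖y‖ * κ * M :=
    (Wy.le_of_opNorm_le (Vy.norm_V_le T hT y) a).trans (mul_le_mul_of_nonneg_left ha hyκ)
  have hWsa : ‖Ws a‖ ≤ D * κ * M := by
    calc ‖Ws a‖ ≤ ‖s n‖ * κ * ‖a‖ := Ws.le_of_opNorm_le (Vy.norm_V_le T hT (s n)) a
      _ ≤ D * κ * M := mul_le_mul (mul_le_mul_of_nonneg_right (hsD n) hκ) ha (norm_nonneg _) hDκ
  have hPy_le : ‖Py‖ ≤ 2 * (‖y‖ * κ * M) := by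
    have h1 : Py = Wy a - Ry := by rw [hdy]; abel
    rw [h1]
    calc ‖Wy a - Ry‖ ≤ ‖Wy a‖ + ‖Ry‖ := norm_sub_le _ _
      _ ≤ ‖y‖ * κ * M + ‖T‖ ^ (N + 1) * (‖y‖ * κ) * M := add_le_add hWya hRy_le
      _ ≤ ‖y‖ * κ * M + 1 * (‖y‖ * κ) * M :=
          add_le_add le_rfl (mul_le_mul_of_nonneg_right (mul_le_mul_of_nonneg_right hT1 hyκ) hM)
      _ = 2 * (‖y‖ * κ * M) := by ring
  -- split the inner product
  have hsplit : ⟪Wy a, Ws a⟫_ℂ = ⟪Py, Ps⟫_ℂ + ⟪Py, Rs⟫_ℂ + ⟪Ry, Ws a⟫_ℂ := by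
    rw [hdy, inner_add_left, hds, inner_add_right]
  -- the finite part
  have hfin : ‖⟪Py, Ps⟫_ℂ‖ ≤ M ^ 2 * F n := by
    have hexp : ⟪Py, Ps⟫_ℂ = ∑ i ∈ Finset.range (N + 1), ∑ j ∈ Finset.range (N + 1),
        (starRingEnd ℂ) (a i) * (a j * ⟪(T ^ i) y, (T ^ j) (s n)⟫_ℂ) := by
      rw [hPy, hPs, sum_inner]
      refine Finset.sum_congr rfl fun i _ => ?_
      rw [inner_sum]
      refine Finset.sum_congr rfl fun j _ => ?_
      rw [inner_smul_left, inner_smul_right]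
    rw [hexp]
    calc ‖∑ i ∈ Finset.range (N + 1), ∑ j ∈ Finset.range (N + 1),
            (starRingEnd ℂ) (a i) * (a j * ⟪(T ^ i) y, (T ^ j) (s n)⟫_ℂ)‖
        ≤ ∑ i ∈ Finset.range (N + 1), ‖∑ j ∈ Finset.range (N + 1),
            (starRingEnd ℂ) (a i) * (a j * ⟪(T ^ i) y, (T ^ j) (s n)⟫_ℂ)‖ := norm_sum_le _ _
      _ ≤ ∑ i ∈ Finset.range (N + 1), ∑ j ∈ Finset.range (N + 1),
            ‖(starRingEnd ℂ) (a i) * (a j * ⟪(T ^ i) y, (T ^ j) (s n)⟫_ℂ)‖ :=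
          Finset.sum_le_sum fun i _ => norm_sum_le _ _
      _ ≤ ∑ i ∈ Finset.range (N + 1), ∑ j ∈ Finset.range (N + 1),
            M * (M * ‖⟪(T ^ i) y, (T ^ j) (s n)⟫_ℂ‖) := by
          refine Finset.sum_le_sum fun i _ => Finset.sum_le_sum fun j _ => ?_
          rw [norm_mul, norm_mul, RCLike.norm_conj]
          exact mul_le_mul (hai i) (mul_le_mul_of_nonneg_right (hai j) (norm_nonneg _))
            (mul_nonneg (norm_nonneg _) (norm_nonneg _)) hM
      _ = M ^ 2 * F n := by
          rw [hF]
          simp only [← Finset.mul_sum]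
          ring
  have hfin' : M ^ 2 * F n ≤ η / 2 := by
    have h1 : M ^ 2 * F n ≤ M ^ 2 * (η / 2 / (M ^ 2 + 1)) := mul_le_mul_of_nonneg_left hn (sq_nonneg _)
    have h2 : M ^ 2 * (η / 2 / (M ^ 2 + 1)) = (η / 2) * (M ^ 2 / (M ^ 2 + 1)) := by ring
    have h3 : M ^ 2 / (M ^ 2 + 1) ≤ 1 := by
      rw [div_le_one (by positivity)]
      linarith
    have h4 : (η / 2) * (M ^ 2 / (M ^ 2 + 1)) ≤ (η / 2) * 1 := mul_le_mul_of_nonneg_left h3 (half_pos hη).le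
    linarith
  -- the two tail terms
  have htail : ‖⟪Py, Rs⟫_ℂ‖ + ‖⟪Ry, Ws a⟫_ℂ‖ ≤ η / 2 := by
    have h1 : ‖⟪Py, Rs⟫_ℂ‖ ≤ (2 * (‖y‖ * κ * M)) * (‖T‖ ^ (N + 1) * (D * κ) * M) :=
      (norm_inner_le_norm _ _).trans (mul_le_mul hPy_le hRs_le (norm_nonneg _)
        (mul_nonneg (by norm_num) (mul_nonneg hyκ hM)))
    have h2 : ‖⟪Ry, Ws a⟫_ℂ‖ ≤ (‖T‖ ^ (N + 1) * (‖y‖ * κ) * M) * (D * κ * M) :=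
      (norm_inner_le_norm _ _).trans (mul_le_mul hRy_le hWsa (norm_nonneg _)
        (mul_nonneg (mul_nonneg hTN hyκ) hM))
    have h3 : (2 * (‖y‖ * κ * M)) * (‖T‖ ^ (N + 1) * (D * κ) * M) +
        (‖T‖ ^ (N + 1) * (‖y‖ * κ) * M) * (D * κ * M) = ‖T‖ ^ (N + 1) * (3 * κ ^ 2 * ‖y‖ * D * M ^ 2) := by
      ring
    have h4 : ‖T‖ ^ (N + 1) * (3 * κ ^ 2 * ‖y‖ * D * M ^ 2) ≤ ‖T‖ ^ (N + 1) * Cst :=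
      mul_le_mul_of_nonneg_left (by rw [hCst]; linarith) hTN
    linarith
  calc ‖⟪Wy a, Ws a⟫_ℂ‖ = ‖⟪Py, Ps⟫_ℂ + ⟪Py, Rs⟫_ℂ + ⟪Ry, Ws a⟫_ℂ‖ := by rw [hsplit]
    _ ≤ ‖⟪Py, Ps⟫_ℂ‖ + ‖⟪Py, Rs⟫_ℂ‖ + ‖⟪Ry, Ws a⟫_ℂ‖ := norm_add₃_le
    _ ≤ η := by linarith

/-- **"`‖ℓ_n(T) L s_n‖ < 2`" (v2 p.22), in the form that holds:** for `L > 0` and every `M`, for all sufficiently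
large `n`, every coefficient sequence `a` with `‖a‖ ≤ M` whose move `V_{y + L s_n} a` has norm `≤ 1.3` (e.g. lies
in the `0.3`-ball at the unit vector `x₀`) satisfies `L‖V_{s_n} a‖ ≤ 7/5`.  (`‖V_y a + L V_{s_n} a‖² ≤ 1.69` and the
cross term is eventually `≥ −0.135`, so `(L‖V_{s_n} a‖)² ≤ 1.96`.)  As printed — for a fixed `n` — the claim is
unsupported. [cite: Enflo2023, v2 p.22; repaired] -/
theorem eventually_L_norm_Vs_le [CompleteSpace H] (T : H →L[ℂ] H) (hT : ‖T‖ < 1) (y : H) {s : ℕ → H}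
    {D : ℝ} (hsD : ∀ n, ‖s n‖ ≤ D) (hs : ∀ v : H, Tendsto (fun n => ⟪v, s n⟫_ℂ) atTop (𝓝 0))
    (M : ℝ) {L : ℝ} (hL : 0 < L) :
    ∀ᶠ n in atTop, ∀ a : Vy.ℓ2, ‖a‖ ≤ M → ‖Vy.V T hT (y + (L : ℂ) • s n) a‖ ≤ 13 / 10 →
      L * ‖Vy.V T hT (s n) a‖ ≤ 7 / 5 := by
  have hη : (0 : ℝ) < 27 / (200 * L) := by positivity
  filter_upwards [cross_small T hT y hsD hs M hη] with n hn
  intro a ha hVa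
  have hcross : ‖⟪Vy.V T hT y a, Vy.V T hT (s n) a⟫_ℂ‖ ≤ 27 / (200 * L) := hn a ha
  have hsplit : Vy.V T hT (y + (L : ℂ) • s n) a = Vy.V T hT y a + (L : ℂ) • Vy.V T hT (s n) a :=
    V_data_add_smul T hT y (s n) (L : ℂ) a
  set X : ℝ := L * ‖Vy.V T hT (s n) a‖ with hX
  have hX0 : 0 ≤ X := mul_nonneg hL.le (norm_nonneg _)
  have h1 : ‖Vy.V T hT y a + (L : ℂ) • Vy.V T hT (s n) a‖ ^ 2 ≤ (13 / 10) ^ 2 := by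
    rw [← hsplit]; exact pow_le_pow_left₀ (norm_nonneg _) hVa 2
  have h2 : ‖Vy.V T hT y a + (L : ℂ) • Vy.V T hT (s n) a‖ ^ 2 = ‖Vy.V T hT y a‖ ^ 2 +
      2 * re ⟪Vy.V T hT y a, (L : ℂ) • Vy.V T hT (s n) a⟫_ℂ + ‖(L : ℂ) • Vy.V T hT (s n) a‖ ^ 2 :=
    @norm_add_sq ℂ _ _ _ _ _ _
  have h3 : ‖(L : ℂ) • Vy.V T hT (s n) a‖ = X := by
    rw [norm_smul, Complex.norm_real, Real.norm_of_nonneg hL.le]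
  have h4 : re ⟪Vy.V T hT y a, (L : ℂ) • Vy.V T hT (s n) a⟫_ℂ =
      L * re ⟪Vy.V T hT y a, Vy.V T hT (s n) a⟫_ℂ := by
    rw [inner_smul_right, re_ofReal_mul']
  have h5 : -(27 / 200) ≤ L * re ⟪Vy.V T hT y a, Vy.V T hT (s n) a⟫_ℂ := by
    have h6 : |re ⟪Vy.V T hT y a, Vy.V T hT (s n) a⟫_ℂ| ≤ 27 / (200 * L) :=
      (abs_re_le_norm _).trans hcross
    have h7 := neg_le_of_abs_le h6
    have h8 : L * (-(27 / (200 * L))) = -(27 / 200) := by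
      field_simp
    rw [← h8]
    exact mul_le_mul_of_nonneg_left h7 hL.le
  rw [h2, h3, h4] at h1
  have h9 : X ^ 2 ≤ (7 / 5) ^ 2 := by linarith [sq_nonneg ‖Vy.V T hT y a‖]
  exact (pow_le_pow_iff_left₀ hX0 (by norm_num) two_ne_zero).1 h9

/-! ### (47), case `M(L₀) < ∞` -/

/-- **(47), case `M(L₀) < ∞`** (v2 p.22: "If the `(εθ)`'s here were bounded from below `(εθ)_n > 0` we could find,
for some `L > L₀`, move `y₀ + L s_n` within `0.3 − δ'`, `δ' > 0`, with a uniform bound on the `‖ℓ_n(T)‖`'s, which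
would be a contradiction") — CLOSED for the repaired threshold: if `Good_ev(L₀)` holds and `Good_ev` fails at `L ≥ L₀`
arbitrarily close to `L₀`, then for every `c > 0` there are infinitely many `n` with a MINIMAL move `a` of
`y + L₀ s_n` into the `0.3`-ball at `x₀` whose `(εθ) = Re⟨x₀ − V a, V a⟩ ∈ [0, c)`.  Mechanism: were `(εθ) ≥ c`
along a tail, the scaled moves `(1 + (εθ)/2) a_n` (`norm_scale_sub_sq_le`) reach distance `≤ 0.3 − 5c²/6` with
norm `≤ 2M(L₀)`, hence still distance `≤ 0.3` for the data `y + L s_n`, `L ∈ [L₀, L₀ + h]` (`h > 0` explicit) —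
`Good_ev(L)`, contradicting the threshold.  `(εθ) ≥ 0` is (6)/KKT (`IsMinimal.kkt`).  Weak nullity and (20) are not
used here. [cite: Enflo2023, v2 p.22, (47)] -/
theorem eq47_of_movesBoundedEv [CompleteSpace H] (T : H →L[ℂ] H) (hT : ‖T‖ < 1) {x₀ y : H} {s : ℕ → H}
    {D L₀ : ℝ} (hx₀ : ‖x₀‖ = 1) (hsD : ∀ n, ‖s n‖ ≤ D)
    (hgood : MovesBoundedEv T hT x₀ y s L₀)
    (habove : ∀ δ > 0, ∃ L, L₀ ≤ L ∧ L < L₀ + δ ∧ 0 < L ∧ ¬ MovesBoundedEv T hT x₀ y s L)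
    {c : ℝ} (hc : 0 < c) (N : ℕ) :
    ∃ n, N ≤ n ∧ ∃ a : Vy.ℓ2, IsMinimal (Vy.V T hT (y + (L₀ : ℂ) • s n)) x₀ (3 / 10) a ∧
      0 ≤ re ⟪x₀ - Vy.V T hT (y + (L₀ : ℂ) • s n) a, Vy.V T hT (y + (L₀ : ℂ) • s n) a⟫_ℂ ∧
      re ⟪x₀ - Vy.V T hT (y + (L₀ : ℂ) • s n) a, Vy.V T hT (y + (L₀ : ℂ) • s n) a⟫_ℂ < c := by
  obtain ⟨M₀, n₀, hmoves⟩ := hgood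
  have hM₀ : 0 ≤ M₀ := by
    obtain ⟨a, ha, -⟩ := hmoves n₀ le_rfl
    exact (norm_nonneg a).trans ha
  have hD : 0 ≤ D := (norm_nonneg _).trans (hsD 0)
  set κ : ℝ := Real.sqrt (1 / (1 - ‖T‖ ^ 2)) with hκ_def
  have hκ : 0 ≤ κ := Real.sqrt_nonneg _
  by_contra hcon
  push Not at hcon
  -- key step: for `n ≥ max N n₀` a move of norm `≤ 2M₀` into the `(0.3 − 5c²/6)`-ball at `L₀`
  have key : ∀ n, max N n₀ ≤ n → ∃ b : Vy.ℓ2, ‖b‖ ≤ 2 * M₀ ∧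
      ‖Vy.V T hT (y + (L₀ : ℂ) • s n) b - x₀‖ ≤ 3 / 10 - 5 * c ^ 2 / 6 := by
    intro n hn
    have hNn : N ≤ n := (le_max_left _ _).trans hn
    have hn₀n : n₀ ≤ n := (le_max_right _ _).trans hn
    obtain ⟨a₁, ha₁M, ha₁⟩ := hmoves n hn₀n
    set W := Vy.V T hT (y + (L₀ : ℂ) • s n) with hW
    have hfeas : a₁ ∈ feasible W x₀ (3 / 10) := by
      rw [mem_feasible, norm_sub_rev]; exact ha₁
    obtain ⟨a, ha⟩ := exists_isMinimal W x₀ (3 / 10) ⟨a₁, hfeas⟩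
    have haM : ‖a‖ ≤ M₀ := (ha.norm_le hfeas).trans ha₁M
    have ha0 : a ≠ 0 := ha.ne_zero (by rw [hx₀]; norm_num)
    obtain ⟨C, hC0, hC⟩ := ha.kkt ha0
    have he0 : 0 ≤ re ⟪x₀ - W a, W a⟫_ℂ := by
      have h := IsMinimal.etheta_nonneg hC0 hC
      simpa only [RCLike.re_to_complex] using h
    have hce : c ≤ re ⟪x₀ - W a, W a⟫_ℂ := hcon n hNn a ha he0
    set e : ℝ := re ⟪x₀ - W a, W a⟫_ℂ with he_def
    have hWa_sub : ‖x₀ - W a‖ ≤ 3 / 10 := ha.norm_sub_le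
    have hWa : ‖W a‖ ≤ 13 / 10 := by
      have h := norm_le_one_add_of_norm_sub_le hx₀ hWa_sub
      linarith
    have he_le : e ≤ 39 / 100 := by
      calc e ≤ ‖x₀ - W a‖ * ‖W a‖ := etheta_le_mul
        _ ≤ (3 / 10) * (13 / 10) := mul_le_mul hWa_sub hWa (norm_nonneg _) (by norm_num)
        _ = 39 / 100 := by norm_num
    have hq : ‖W a‖ ^ 2 ≤ 2 := (pow_le_pow_left₀ (norm_nonneg _) hWa 2).trans (by norm_num)
    have hscale := norm_scale_sub_sq_le (x₀ := x₀) (y' := W a) (by norm_num : (0 : ℝ) < 2) hq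
    rw [← he_def] at hscale
    set b : Vy.ℓ2 := ((1 + e / 2 : ℝ) : ℂ) • a with hb
    have hWb : W b = ((1 + e / 2 : ℝ) : ℂ) • W a := by rw [hb, map_smul]
    have he1 : 0 ≤ 1 + e / 2 := by linarith
    refine ⟨b, ?_, ?_⟩
    · have h1 : ‖b‖ = (1 + e / 2) * ‖a‖ := by
        rw [hb, norm_smul, Complex.norm_real, Real.norm_of_nonneg he1]
      rw [h1]
      calc (1 + e / 2) * ‖a‖ ≤ 2 * ‖a‖ := mul_le_mul_of_nonneg_right (by linarith) (norm_nonneg _)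
        _ ≤ 2 * M₀ := by linarith
    · set u : ℝ := ‖W b - x₀‖ with hu
      have hu0 : 0 ≤ u := norm_nonneg _
      have h1 : u ^ 2 ≤ 9 / 100 - c ^ 2 / 2 := by
        have h2 : ‖W a - x₀‖ ^ 2 ≤ (3 / 10) ^ 2 :=
          pow_le_pow_left₀ (norm_nonneg _) (by rwa [norm_sub_rev]) 2
        have h3 : c ^ 2 ≤ e ^ 2 := pow_le_pow_left₀ hc.le hce 2
        rw [hu, hWb]
        linarith
      have h4 : u ≤ 3 / 10 := by
        have h5 : u ^ 2 ≤ (3 / 10) ^ 2 := by linarith [sq_nonneg c]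
        exact (pow_le_pow_iff_left₀ hu0 (by norm_num) two_ne_zero).1 h5
      linarith [h1, sq_nonneg (3 / 10 - u)]
  -- the perturbation `L₀ ↦ L ∈ [L₀, L₀ + h]` keeps the scaled moves inside the `0.3`-ball
  have hX : 0 ≤ 2 * M₀ * (D * κ) := mul_nonneg (mul_nonneg (by norm_num) hM₀) (mul_nonneg hD hκ)
  have hpos : 0 < 2 * M₀ * (D * κ) + 1 := by linarith
  set h : ℝ := (5 * c ^ 2 / 6) / (2 * M₀ * (D * κ) + 1) with hh
  have hc2 : 0 < 5 * c ^ 2 / 6 := by positivity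
  have hh0 : 0 < h := div_pos hc2 hpos
  obtain ⟨L, hL₀L, hLlt, -, hnot⟩ := habove h hh0
  apply hnot
  refine ⟨2 * M₀, max N n₀, fun n hn => ?_⟩
  obtain ⟨b, hbM, hb⟩ := key n hn
  refine ⟨b, hbM, ?_⟩
  have hsplit : Vy.V T hT (y + (L : ℂ) • s n) b =
      Vy.V T hT (y + (L₀ : ℂ) • s n) b + ((L - L₀ : ℝ) : ℂ) • Vy.V T hT (s n) b := by
    have h1 : y + (L : ℂ) • s n = (y + (L₀ : ℂ) • s n) + ((L - L₀ : ℝ) : ℂ) • s n := by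
      push_cast
      rw [sub_smul]
      abel
    rw [h1, V_data_add_smul]
  have hpert : ‖((L - L₀ : ℝ) : ℂ) • Vy.V T hT (s n) b‖ ≤ h * (2 * M₀ * (D * κ)) := by
    rw [norm_smul, Complex.norm_real, Real.norm_of_nonneg (by linarith)]
    have h1 : ‖Vy.V T hT (s n) b‖ ≤ ‖s n‖ * κ * ‖b‖ :=
      (Vy.V T hT (s n)).le_of_opNorm_le (Vy.norm_V_le T hT (s n)) b
    have h2 : ‖s n‖ * κ * ‖b‖ ≤ D * κ * (2 * M₀) :=
      mul_le_mul (mul_le_mul_of_nonneg_right (hsD n) hκ) hbM (norm_nonneg _) (mul_nonneg hD hκ)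
    calc (L - L₀) * ‖Vy.V T hT (s n) b‖ ≤ h * (D * κ * (2 * M₀)) :=
          mul_le_mul (by linarith) (h1.trans h2) (norm_nonneg _) hh0.le
      _ = h * (2 * M₀ * (D * κ)) := by ring
  have hfrac : h * (2 * M₀ * (D * κ)) ≤ 5 * c ^ 2 / 6 := by
    have h1 : h * (2 * M₀ * (D * κ)) ≤ h * (2 * M₀ * (D * κ) + 1) :=
      mul_le_mul_of_nonneg_left (by linarith) hh0.le
    have h2 : h * (2 * M₀ * (D * κ) + 1) = 5 * c ^ 2 / 6 := by
      rw [hh, div_mul_cancel₀ _ hpos.ne']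
    linarith
  calc ‖Vy.V T hT (y + (L : ℂ) • s n) b - x₀‖
      = ‖(Vy.V T hT (y + (L₀ : ℂ) • s n) b - x₀) + ((L - L₀ : ℝ) : ℂ) • Vy.V T hT (s n) b‖ := by
        rw [hsplit]; congr 1; abel
    _ ≤ ‖Vy.V T hT (y + (L₀ : ℂ) • s n) b - x₀‖ + ‖((L - L₀ : ℝ) : ℂ) • Vy.V T hT (s n) b‖ :=
        norm_add_le _ _
    _ ≤ (3 / 10 - 5 * c ^ 2 / 6) + h * (2 * M₀ * (D * κ)) := add_le_add hb hpert
    _ ≤ 3 / 10 := by linarith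

/-! ### (47), case `M(L₀) = ∞` -/

/-- **(47), case `M(L₀) = ∞`** (v2 p.22: "for moving `y₀ + L₀ s_n` by minimal `ℓ(T)`'s between the distances
`0.3 + δ` and `0.3` to `x₀`, may require arbitrarily small `(εθ)`'s") — CLOSED for the repaired threshold: if
`Good_ev(L)` for all `0 < L < L₀` but not at `L₀`, then for every `c > 0`, `δ > 0` there are infinitely many `n` and
a radius `r ∈ [0.3, 0.3 + δ]` with a MINIMAL move of `y + L₀ s_n` into the `r`-ball at `x₀` whose `(εθ) ∈ [0, c)`.
Mechanism: take `L = L₀(1 − δ'/3)` just below `L₀` and `M = M(L)`; by `eventually_L_norm_Vs_le` (weak nullity!)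
the `L`-moves `a_n` satisfy `(L₀ − L)‖V_{s_n} a_n‖ ≤ δ'` for large `n`, so they are feasible at radius `0.3 + δ'`
for the data `y + L₀ s_n` (the text's perturbation line); at a bad index `n` (no `0.3`-move of norm `≤ 2M`, from
`¬Good_ev(L₀)`) the minimal move at radius `0.3 + δ'` has norm `≤ M`, and `(εθ) ≥ c` would let the scaled move
reach the `0.3`-ball with norm `≤ 2M` (`norm_scale_sub_sq_le`, `δ' ≤ c²/2`) — contradiction.
[cite: Enflo2023, v2 p.22, (47)] -/
theorem eq47_of_not_movesBoundedEv [CompleteSpace H] (T : H →L[ℂ] H) (hT : ‖T‖ < 1) {x₀ y : H}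
    {s : ℕ → H} {D L₀ : ℝ} (hx₀ : ‖x₀‖ = 1) (hsD : ∀ n, ‖s n‖ ≤ D)
    (hs : ∀ v : H, Tendsto (fun n => ⟪v, s n⟫_ℂ) atTop (𝓝 0)) (hL₀ : 0 < L₀)
    (hbelow : ∀ L, 0 < L → L < L₀ → MovesBoundedEv T hT x₀ y s L)
    (hbad : ¬ MovesBoundedEv T hT x₀ y s L₀) {c : ℝ} (hc : 0 < c) {δ : ℝ} (hδ : 0 < δ) (N : ℕ) :
    ∃ n, N ≤ n ∧ ∃ r : ℝ, 3 / 10 ≤ r ∧ r ≤ 3 / 10 + δ ∧ ∃ a : Vy.ℓ2,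
      IsMinimal (Vy.V T hT (y + (L₀ : ℂ) • s n)) x₀ r a ∧
      0 ≤ re ⟪x₀ - Vy.V T hT (y + (L₀ : ℂ) • s n) a, Vy.V T hT (y + (L₀ : ℂ) • s n) a⟫_ℂ ∧
      re ⟪x₀ - Vy.V T hT (y + (L₀ : ℂ) • s n) a, Vy.V T hT (y + (L₀ : ℂ) • s n) a⟫_ℂ < c := by
  -- the auxiliary width `δ'`
  set δ' : ℝ := min δ (min (1 / 10) (c ^ 2 / 2)) with hδ'
  have hδ'0 : 0 < δ' := lt_min hδ (lt_min (by norm_num) (by positivity))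
  have hδ'δ : δ' ≤ δ := min_le_left _ _
  have hδ'1 : δ' ≤ 1 / 10 := (min_le_right _ _).trans (min_le_left _ _)
  have hδ'c : δ' ≤ c ^ 2 / 2 := (min_le_right _ _).trans (min_le_right _ _)
  -- `L` just below `L₀`
  set L : ℝ := L₀ * (1 - δ' / 3) with hL_def
  have hL0 : 0 < L := mul_pos hL₀ (by linarith)
  have hLL₀ : L < L₀ := by
    have h1 : 0 < L₀ * δ' := mul_pos hL₀ hδ'0
    rw [hL_def]; linarith
  have hL₀L : L₀ - L = L₀ * δ' / 3 := by rw [hL_def]; ring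
  obtain ⟨M, n₀, hmoves⟩ := hbelow L hL0 hLL₀
  have hM : 0 ≤ M := by
    obtain ⟨a, ha, -⟩ := hmoves n₀ le_rfl
    exact (norm_nonneg a).trans ha
  obtain ⟨n₂, hn₂⟩ := (eventually_L_norm_Vs_le T hT y hsD hs M hL0).exists_forall_of_atTop
  -- a bad index beyond `N`, `n₀`, `n₂`
  have hbad' : ∃ n, max N (max n₀ n₂) ≤ n ∧
      ∀ a : Vy.ℓ2, ‖a‖ ≤ 2 * M → ¬ ‖Vy.V T hT (y + (L₀ : ℂ) • s n) a - x₀‖ ≤ 3 / 10 := by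
    by_contra hcon
    push Not at hcon
    exact hbad ⟨2 * M, max N (max n₀ n₂), fun n hn => hcon n hn⟩
  obtain ⟨n, hn, hnobad⟩ := hbad'
  have hNn : N ≤ n := (le_max_left _ _).trans hn
  have hn₀n : n₀ ≤ n := ((le_max_left _ _).trans (le_max_right N _)).trans hn
  have hn₂n : n₂ ≤ n := ((le_max_right _ _).trans (le_max_right N _)).trans hn
  obtain ⟨aL, haLM, haL⟩ := hmoves n hn₀n
  set W := Vy.V T hT (y + (L₀ : ℂ) • s n) with hW
  set WL := Vy.V T hT (y + (L : ℂ) • s n) with hWL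
  -- the `L`-move is feasible at radius `0.3 + δ'` for the data at `L₀`
  have hWLa : ‖WL aL‖ ≤ 13 / 10 := by
    have h := norm_le_one_add_of_norm_sub_le hx₀ (show ‖x₀ - WL aL‖ ≤ 3 / 10 by rwa [norm_sub_rev])
    linarith
  have hVs : L * ‖Vy.V T hT (s n) aL‖ ≤ 7 / 5 := hn₂ n hn₂n aL haLM hWLa
  set r₁ : ℝ := 3 / 10 + δ' with hr₁
  have hsplit : W aL = WL aL + ((L₀ - L : ℝ) : ℂ) • Vy.V T hT (s n) aL := by
    have h1 : y + (L₀ : ℂ) • s n = (y + (L : ℂ) • s n) + ((L₀ - L : ℝ) : ℂ) • s n := by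
      push_cast
      rw [sub_smul]
      abel
    rw [hW, h1, V_data_add_smul]
  have hpert : ‖((L₀ - L : ℝ) : ℂ) • Vy.V T hT (s n) aL‖ ≤ δ' := by
    rw [norm_smul, Complex.norm_real, Real.norm_of_nonneg (by linarith), hL₀L]
    have hVs0 : 0 ≤ ‖Vy.V T hT (s n) aL‖ := norm_nonneg _
    have h1 : L₀ * ‖Vy.V T hT (s n) aL‖ ≤ 3 := by
      have h2 : L₀ * ‖Vy.V T hT (s n) aL‖ =
          L * ‖Vy.V T hT (s n) aL‖ + (L₀ * δ' / 3) * ‖Vy.V T hT (s n) aL‖ := by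
        rw [hL_def]; ring
      have h3 : (L₀ * δ' / 3) * ‖Vy.V T hT (s n) aL‖ ≤ (L₀ * (1 / 10) / 3) * ‖Vy.V T hT (s n) aL‖ := by
        have h4 : L₀ * δ' ≤ L₀ * (1 / 10) := mul_le_mul_of_nonneg_left hδ'1 hL₀.le
        exact mul_le_mul_of_nonneg_right (by linarith) hVs0
      -- `L₀‖V_s aL‖ ≤ 7/5 + L₀‖V_s aL‖/30`, so `L₀‖V_s aL‖ ≤ 42/29 < 3`
      linarith [hVs, h2, h3]
    calc L₀ * δ' / 3 * ‖Vy.V T hT (s n) aL‖ = (δ' / 3) * (L₀ * ‖Vy.V T hT (s n) aL‖) := by ring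
      _ ≤ (δ' / 3) * 3 := mul_le_mul_of_nonneg_left h1 (by linarith)
      _ = δ' := by ring
  have hfeas : aL ∈ feasible W x₀ r₁ := by
    rw [mem_feasible, norm_sub_rev, hsplit,
      show WL aL + ((L₀ - L : ℝ) : ℂ) • Vy.V T hT (s n) aL - x₀ =
        (WL aL - x₀) + ((L₀ - L : ℝ) : ℂ) • Vy.V T hT (s n) aL by abel]
    calc ‖(WL aL - x₀) + ((L₀ - L : ℝ) : ℂ) • Vy.V T hT (s n) aL‖
        ≤ ‖WL aL - x₀‖ + ‖((L₀ - L : ℝ) : ℂ) • Vy.V T hT (s n) aL‖ := norm_add_le _ _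
      _ ≤ 3 / 10 + δ' := add_le_add haL hpert
  -- the minimal move at radius `0.3 + δ'`
  obtain ⟨a, ha⟩ := exists_isMinimal W x₀ r₁ ⟨aL, hfeas⟩
  have haM : ‖a‖ ≤ M := (ha.norm_le hfeas).trans haLM
  have hr₁1 : r₁ < ‖x₀‖ := by rw [hx₀]; linarith
  have ha0 : a ≠ 0 := ha.ne_zero hr₁1
  obtain ⟨C, hC0, hC⟩ := ha.kkt ha0
  have he0 : 0 ≤ re ⟪x₀ - W a, W a⟫_ℂ := by
    have h := IsMinimal.etheta_nonneg hC0 hC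
    simpa only [RCLike.re_to_complex] using h
  refine ⟨n, hNn, r₁, by linarith, by linarith, a, ha, he0, ?_⟩
  -- `(εθ) < c`: otherwise the scaled move contradicts the badness of `n`
  set e : ℝ := re ⟪x₀ - W a, W a⟫_ℂ with he_def
  by_contra hce
  push Not at hce
  have hWa_sub : ‖x₀ - W a‖ ≤ r₁ := ha.norm_sub_le
  have hWa : ‖W a‖ ≤ 7 / 5 := by
    have h := norm_le_one_add_of_norm_sub_le hx₀ hWa_sub
    linarith
  have hr₁0 : 0 ≤ r₁ := by linarith
  have he_le : e ≤ 14 / 25 := by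
    calc e ≤ ‖x₀ - W a‖ * ‖W a‖ := etheta_le_mul
      _ ≤ (2 / 5) * (7 / 5) := mul_le_mul (by linarith) hWa (norm_nonneg _) (by norm_num)
      _ = 14 / 25 := by norm_num
  have hq : ‖W a‖ ^ 2 ≤ 2 := (pow_le_pow_left₀ (norm_nonneg _) hWa 2).trans (by norm_num)
  have hscale := norm_scale_sub_sq_le (x₀ := x₀) (y' := W a) (by norm_num : (0 : ℝ) < 2) hq
  rw [← he_def] at hscale
  set b : Vy.ℓ2 := ((1 + e / 2 : ℝ) : ℂ) • a with hb
  have hWb : W b = ((1 + e / 2 : ℝ) : ℂ) • W a := by rw [hb, map_smul]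
  have he1 : 0 ≤ 1 + e / 2 := by linarith
  have hbM : ‖b‖ ≤ 2 * M := by
    have h1 : ‖b‖ = (1 + e / 2) * ‖a‖ := by
      rw [hb, norm_smul, Complex.norm_real, Real.norm_of_nonneg he1]
    rw [h1]
    calc (1 + e / 2) * ‖a‖ ≤ 2 * ‖a‖ := mul_le_mul_of_nonneg_right (by linarith) (norm_nonneg _)
      _ ≤ 2 * M := by linarith
  have hbfeas : ‖W b - x₀‖ ≤ 3 / 10 := by
    have h1 : ‖W b - x₀‖ ^ 2 ≤ (3 / 10) ^ 2 := by
      have h2 : ‖W a - x₀‖ ^ 2 ≤ r₁ ^ 2 :=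
        pow_le_pow_left₀ (norm_nonneg _) (by rwa [norm_sub_rev]) 2
      have h3 : c ^ 2 ≤ e ^ 2 := pow_le_pow_left₀ hc.le hce 2
      have h4 : r₁ ^ 2 ≤ 9 / 100 + c ^ 2 / 2 := by
        have h5 : δ' * δ' ≤ δ' * (1 / 10) := mul_le_mul_of_nonneg_left hδ'1 hδ'0.le
        have h6 : (3 / 10 + δ') ^ 2 = 9 / 100 + 3 / 5 * δ' + δ' * δ' := by ring
        rw [hr₁, h6]
        linarith [sq_nonneg c]
      rw [hWb]
      linarith
    exact (pow_le_pow_iff_left₀ (norm_nonneg _) (by norm_num) two_ne_zero).1 h1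
  exact hnobad b hbM hbfeas

/-- **(47) for the repaired threshold** (both cases): with `Good_ev(L)` for `0 < L < L₀` and `¬Good_ev` at `L ≥ L₀`
arbitrarily close to `L₀` (`type2_thresholdEv_or_NIS`), for every `c > 0`, `δ > 0` there are infinitely many `n`
and a radius `r ∈ [0.3, 0.3 + δ]` with a minimal move of `y + L₀ s_n` into the `r`-ball at `x₀` of `(εθ) ∈ [0, c)`
— "we will find a sequence `y'_n = y₀' + L₀ s_n` and `δ_n → 0` such that … `(εθ)_n` tending to `0` and
`‖x₀ − y'_{n₁}‖ = 0.3` (or `0.3 + δ_n`)" (v2 p.22; the equality of the distance is `IsMinimal.norm_sub_eq`).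
[cite: Enflo2023, v2 p.22, (47); repaired] -/
theorem eq47 [CompleteSpace H] (T : H →L[ℂ] H) (hT : ‖T‖ < 1) {x₀ y : H} {s : ℕ → H} {D L₀ : ℝ}
    (hx₀ : ‖x₀‖ = 1) (hsD : ∀ n, ‖s n‖ ≤ D) (hs : ∀ v : H, Tendsto (fun n => ⟪v, s n⟫_ℂ) atTop (𝓝 0))
    (hL₀ : 0 < L₀) (hbelow : ∀ L, 0 < L → L < L₀ → MovesBoundedEv T hT x₀ y s L)
    (habove : ∀ δ > 0, ∃ L, L₀ ≤ L ∧ L < L₀ + δ ∧ 0 < L ∧ ¬ MovesBoundedEv T hT x₀ y s L)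
    {c : ℝ} (hc : 0 < c) {δ : ℝ} (hδ : 0 < δ) (N : ℕ) :
    ∃ n, N ≤ n ∧ ∃ r : ℝ, 3 / 10 ≤ r ∧ r ≤ 3 / 10 + δ ∧ ∃ a : Vy.ℓ2,
      IsMinimal (Vy.V T hT (y + (L₀ : ℂ) • s n)) x₀ r a ∧
      0 ≤ re ⟪x₀ - Vy.V T hT (y + (L₀ : ℂ) • s n) a, Vy.V T hT (y + (L₀ : ℂ) • s n) a⟫_ℂ ∧
      re ⟪x₀ - Vy.V T hT (y + (L₀ : ℂ) • s n) a, Vy.V T hT (y + (L₀ : ℂ) • s n) a⟫_ℂ < c := by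
  by_cases hgood : MovesBoundedEv T hT x₀ y s L₀
  · obtain ⟨n, hn, a, ha, he0, hec⟩ := eq47_of_movesBoundedEv T hT hx₀ hsD hgood habove hc N
    exact ⟨n, hn, 3 / 10, le_rfl, by linarith, a, ha, he0, hec⟩
  · exact eq47_of_not_movesBoundedEv T hT hx₀ hsD hs hL₀ hbelow hgood hc hδ N

/-- **End to end, from the definition of type 2 to (47)** (v2 p.7 + pp.20–22, repaired threshold): for `‖T‖ < 1`
with `T†` injective, `T` of type 2 with unit vector `u₀`, and any unit vector `x₀`: either a non-trivial closed
invariant subspace, or the data `m ≥ 1`, `y ≠ 0` (`‖y‖ ≤ 1`, `Re⟨y, u₀⟩ ≥ 1/100`), the weakly null `s_n`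
(`‖s_n‖ ≤ 2`) with (20), the threshold `L₀ > 0` for the eventual moves, AND (47).  The manuscript then restarts the
MC iteration from these `y'_n` (p.22 ff.), where it meets the refuted room claim / (34)–(38) exactly as in the
type-1 branch. [cite: Enflo2023, v2 pp.7, 20–22] -/
theorem eq47_of_type2 [CompleteSpace H] (T : H →L[ℂ] H) (hT : ‖T‖ < 1)
    (hTinj : Function.Injective (ContinuousLinearMap.adjoint T)) (hT2 : Referee.Type2 T)
    (u₀ : H) (hu₀ : ‖u₀‖ = 1) (x₀ : H) (hx₀ : ‖x₀‖ = 1) :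
    HasNontrivialClosedInvariantSubspace T ∨
      ∃ (m : ℕ) (y : H) (s : ℕ → H), 1 ≤ m ∧ y ≠ 0 ∧ ‖y‖ ≤ 1 ∧ (1 / 100 : ℝ) ≤ re ⟪u₀, y⟫_ℂ ∧
        (∀ n, ‖s n‖ ≤ 2) ∧ (∀ v : H, Tendsto (fun n => ⟪v, s n⟫_ℂ) atTop (𝓝 0)) ∧
        (∀ j, m ≤ j → Tendsto (fun n => ⟪y, (T ^ j) y⟫_ℂ + ⟪s n, (T ^ j) (s n)⟫_ℂ) atTop (𝓝 0)) ∧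
        ∃ L₀ : ℝ, 0 < L₀ ∧ (∀ L, 0 < L → L < L₀ → MovesBoundedEv T hT x₀ y s L) ∧
          (∀ δ > 0, ∃ L, L₀ ≤ L ∧ L < L₀ + δ ∧ 0 < L ∧ ¬ MovesBoundedEv T hT x₀ y s L) ∧
          ∀ c > 0, ∀ δ > 0, ∀ N : ℕ, ∃ n, N ≤ n ∧ ∃ r : ℝ, 3 / 10 ≤ r ∧ r ≤ 3 / 10 + δ ∧ ∃ a : Vy.ℓ2,
            IsMinimal (Vy.V T hT (y + (L₀ : ℂ) • s n)) x₀ r a ∧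
            0 ≤ re ⟪x₀ - Vy.V T hT (y + (L₀ : ℂ) • s n) a, Vy.V T hT (y + (L₀ : ℂ) • s n) a⟫_ℂ ∧
            re ⟪x₀ - Vy.V T hT (y + (L₀ : ℂ) • s n) a, Vy.V T hT (y + (L₀ : ℂ) • s n) a⟫_ℂ < c := by
  obtain ⟨m, y, s, hm, hy1, hre, hy0, hs2, hs, h20⟩ := eq20_of_type2 T hT2 u₀ hu₀
  rcases type2_thresholdEv_or_NIS T hT hTinj m hx₀ hy0 hs2 hs h20 with h | ⟨L₀, hL₀, hbelow, habove⟩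
  · exact Or.inl h
  · exact Or.inr ⟨m, y, s, hm, hy0, hy1, hre, hs2, hs, h20, L₀, hL₀, hbelow, habove,
      fun c hc δ hδ N => eq47 T hT hx₀ hs2 hs hL₀ hbelow habove hc hδ N⟩


/-! ### The printed version of (47) fails

With the printed quantifier "for all `n`" (`MovesBounded`), the threshold `L₀` can be created by ONE index while
the minimal moves at all other indices keep `(εθ)` bounded below — so "if `M(L₀) = ∞` then … arbitrarily small
`(εθ)`'s" does not follow.  The example lives inside the setting of the section: `T` any strict contraction with
`‖T‖ ≤ 1/10` (the text has `‖T‖ = 10⁻²⁰`), `x₀` any unit vector, `s_n` unit vectors orthogonal to `x₀` (e.g. an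
orthonormal sequence, which is weakly null; on `ℓ²(ℤ)` with `T = S/10`, `S` the bilateral shift, `x₀ = e₀`,
`s_n = e_n` also (20) holds exactly from `m = 1`, and the rogue index `n = 0` is invisible to (20), (21) and weak
nullity, which only concern `n → ∞`).  Data: `y := (17/20) x₀` (so `‖1·y − x₀‖ ≤ 0.2` as on p.21),
`s'_0 := −(17/4) x₀`, `s'_n := s_n` (`n ≥ 1`). -/

/-- The example's data vector `y := (17/20) x₀` (counterexample data for (47) as printed).
[cite: Enflo2023, v2 p.22, (47)] -/
noncomputable def exY (x₀ : H) : H := ((17 / 20 : ℝ) : ℂ) • x₀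

/-- The rogue sequence: `s'_0 := −(17/4) x₀` (so that `y + (1/5) s'_0 = 0`), `s'_n := s_n` for `n ≥ 1`
(counterexample data for (47) as printed). [cite: Enflo2023, v2 p.22, (47)] -/
noncomputable def rogue (x₀ : H) (s : ℕ → H) : ℕ → H :=
  fun n => if n = 0 then ((-(17 / 4) : ℝ) : ℂ) • x₀ else s n

/-- `s'_0 = −(17/4) x₀`. [folklore] -/
lemma rogue_zero (x₀ : H) (s : ℕ → H) : rogue x₀ s 0 = ((-(17 / 4) : ℝ) : ℂ) • x₀ := by
  simp [rogue]

/-- `s'_n = s_n` for `n ≠ 0`. [folklore] -/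
lemma rogue_of_ne_zero (x₀ : H) (s : ℕ → H) {n : ℕ} (hn : n ≠ 0) : rogue x₀ s n = s n := by
  simp [rogue, hn]

/-- `‖α x₀ + β v‖² = α² + β²` for unit vectors `x₀ ⊥ v` and real `α, β` (Pythagoras). [folklore] -/
lemma norm_sq_combo {x₀ v : H} (hx₀ : ‖x₀‖ = 1) (hv : ‖v‖ = 1) (h0 : ⟪x₀, v⟫_ℂ = 0) (α β : ℝ) :
    ‖((α : ℝ) : ℂ) • x₀ + ((β : ℝ) : ℂ) • v‖ ^ 2 = α ^ 2 + β ^ 2 := by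
  rw [@norm_add_sq ℂ _ _ _ _ _ _]
  simp only [inner_smul_left, inner_smul_right, h0, mul_zero, map_zero, add_zero, norm_smul,
    Complex.norm_real, Real.norm_eq_abs, hx₀, hv, mul_one, sq_abs]

/-- In the example `y + (1/5) s'_0 = 0`. [folklore] -/
lemma exY_add_rogue_zero (x₀ : H) (s : ℕ → H) : exY x₀ + ((1 / 5 : ℝ) : ℂ) • rogue x₀ s 0 = 0 := by
  rw [rogue_zero, exY, smul_smul, ← add_smul]
  have h : ((17 / 20 : ℝ) : ℂ) + ((1 / 5 : ℝ) : ℂ) * ((-(17 / 4) : ℝ) : ℂ) = 0 := by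
    push_cast
    ring
  rw [h, zero_smul]

/-- **Example, part 1: `Good(L)` for `0 < L < 1/5`** (printed, all-`n` version).  At the rogue index the data vector
is `(17/20)(1 − 5L) x₀ ≠ 0` and the move `t·e₀`, `t = 1/((17/20)(1 − 5L))`, lands on `x₀`; at `n ≥ 1` the move `e₀`
(the identity) gives distance `(9/400 + L²)^{1/2} ≤ 1/4`. [cite: Enflo2023, v2 p.20] -/
theorem ex_movesBounded [CompleteSpace H] (T : H →L[ℂ] H) (hT : ‖T‖ < 1) {x₀ : H} (hx₀ : ‖x₀‖ = 1)
    {s : ℕ → H} (hs1 : ∀ n, ‖s n‖ = 1) (hs0 : ∀ n, ⟪x₀, s n⟫_ℂ = 0) {L : ℝ} (hL0 : 0 < L)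
    (hL : L < 1 / 5) : MovesBounded T hT x₀ (exY x₀) (rogue x₀ s) L := by
  have h17 : 0 < (17 / 20 : ℝ) * (1 - 5 * L) := by
    have : 0 < 1 - 5 * L := by linarith
    positivity
  set t : ℝ := 1 / ((17 / 20 : ℝ) * (1 - 5 * L)) with ht
  have ht0 : 0 < t := by rw [ht]; exact div_pos one_pos h17
  refine ⟨max 1 t, fun n => ?_⟩
  rcases Nat.eq_zero_or_pos n with rfl | hn
  · -- the rogue index
    refine ⟨((t : ℝ) : ℂ) • lp.single 2 0 (1 : ℂ), ?_, ?_⟩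
    · rw [norm_smul, Complex.norm_real, Real.norm_of_nonneg ht0.le, lp.norm_single (by norm_num), norm_one,
        mul_one]
      exact le_max_right _ _
    · have hw : exY x₀ + (L : ℂ) • rogue x₀ s 0 = (((17 / 20 : ℝ) * (1 - 5 * L) : ℝ) : ℂ) • x₀ := by
        rw [rogue_zero, exY, smul_smul, ← add_smul]
        congr 1
        push_cast
        ring
      have hts : ((t : ℝ) : ℂ) * (((17 / 20 : ℝ) * (1 - 5 * L) : ℝ) : ℂ) = 1 := by
        rw [← Complex.ofReal_mul, ht, one_div_mul_cancel h17.ne', Complex.ofReal_one]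
      rw [map_smul, hw, Vy.V_single, pow_zero, one_apply_eq_self, smul_smul, hts, one_smul, sub_self,
        norm_zero]
      norm_num
  · -- the other indices: the identity move
    refine ⟨lp.single 2 0 (1 : ℂ), ?_, ?_⟩
    · rw [lp.norm_single (by norm_num), norm_one]
      exact le_max_left _ _
    · rw [rogue_of_ne_zero x₀ s hn.ne', Vy.V_single, pow_zero, one_apply_eq_self, exY]
      have h1 : ((17 / 20 : ℝ) : ℂ) • x₀ + (L : ℂ) • s n - x₀ =
          ((-(3 / 20) : ℝ) : ℂ) • x₀ + (L : ℂ) • s n := by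
        have h2 : ((-(3 / 20) : ℝ) : ℂ) = ((17 / 20 : ℝ) : ℂ) - 1 := by
          push_cast
          norm_num
        rw [h2, sub_smul, one_smul]
        abel
      have h3 : ‖((-(3 / 20) : ℝ) : ℂ) • x₀ + (L : ℂ) • s n‖ ^ 2 ≤ (3 / 10) ^ 2 := by
        rw [norm_sq_combo hx₀ (hs1 n) (hs0 n)]
        have hL2 : L ^ 2 ≤ (1 / 5) ^ 2 := pow_le_pow_left₀ hL0.le hL.le 2
        norm_num at hL2 ⊢
        linarith
      rw [h1]
      exact (pow_le_pow_iff_left₀ (norm_nonneg _) (by norm_num) two_ne_zero).1 h3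

/-- **Example, part 2: `¬Good(1/5)`** (printed version): at the rogue index the data vector is `0`, so no move
reaches the `0.3`-ball around the unit vector `x₀`. [cite: Enflo2023, v2 p.20] -/
theorem ex_not_movesBounded [CompleteSpace H] (T : H →L[ℂ] H) (hT : ‖T‖ < 1) {x₀ : H} (hx₀ : ‖x₀‖ = 1)
    (s : ℕ → H) : ¬ MovesBounded T hT x₀ (exY x₀) (rogue x₀ s) (1 / 5) := by
  rintro ⟨M, hM⟩
  obtain ⟨a, -, ha⟩ := hM 0
  have hV0 : Vy.V T hT (exY x₀ + ((1 / 5 : ℝ) : ℂ) • rogue x₀ s 0) a = 0 := by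
    rw [exY_add_rogue_zero, Vy.V_apply]
    simp
  rw [hV0, zero_sub, norm_neg, hx₀] at ha
  norm_num at ha

/-- **Example, part 3: the printed threshold is exactly `L₀ = 1/5`** — the clauses "`Good(L)` for `0 < L < L₀`"
and "`¬Good(L)` for `L ≥ L₀` arbitrarily close to `L₀`" (the form produced by `type2_threshold_or_NIS`) hold for
`L₀ = 1/5` and for no other value. [cite: Enflo2023, v2 pp.20–21] -/
theorem ex_threshold [CompleteSpace H] (T : H →L[ℂ] H) (hT : ‖T‖ < 1) {x₀ : H} (hx₀ : ‖x₀‖ = 1)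
    {s : ℕ → H} (hs1 : ∀ n, ‖s n‖ = 1) (hs0 : ∀ n, ⟪x₀, s n⟫_ℂ = 0) :
    ((∀ L, 0 < L → L < 1 / 5 → MovesBounded T hT x₀ (exY x₀) (rogue x₀ s) L) ∧
      ∀ δ > 0, ∃ L, 1 / 5 ≤ L ∧ L < 1 / 5 + δ ∧ 0 < L ∧ ¬ MovesBounded T hT x₀ (exY x₀) (rogue x₀ s) L) ∧
    ∀ L₀ : ℝ, (∀ L, 0 < L → L < L₀ → MovesBounded T hT x₀ (exY x₀) (rogue x₀ s) L) →
      (∀ δ > 0, ∃ L, L₀ ≤ L ∧ L < L₀ + δ ∧ 0 < L ∧ ¬ MovesBounded T hT x₀ (exY x₀) (rogue x₀ s) L) →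
      L₀ = 1 / 5 := by
  refine ⟨⟨fun L hL0 hL => ex_movesBounded T hT hx₀ hs1 hs0 hL0 hL, fun δ hδ =>
    ⟨1 / 5, le_rfl, by linarith, by norm_num, ex_not_movesBounded T hT hx₀ s⟩⟩, fun L₀ hbelow habove => ?_⟩
  rcases lt_trichotomy L₀ (1 / 5) with hlt | heq | hgt
  · obtain ⟨L, hL₀L, hLlt, hL0, hnot⟩ := habove (1 / 5 - L₀) (by linarith)
    exact absurd (ex_movesBounded T hT hx₀ hs1 hs0 hL0 (by linarith)) hnot
  · exact heq
  · exact absurd (hbelow (1 / 5) (by norm_num) hgt) (ex_not_movesBounded T hT hx₀ s)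

/-- **Example, part 4: no small `(εθ)` at `L₀ = 1/5`** — at ANY index and ANY radius `r ∈ [0.3, 0.4]`, every
minimal move `a` of `y + L₀ s'_n` into the `r`-ball at `x₀` has `(εθ) = Re⟨x₀ − V a, V a⟩ ≥ 3/100`.  (Index `0`:
nothing is feasible.  Index `n ≥ 1`: `e₀` is feasible, so `‖a‖ ≤ 1` and `‖V a‖² ≤ ‖y + s_n/5‖²/(1 − ‖T‖²) ≤
(305/400)(100/99)`, whence `(εθ) ≥ (1 − r² − ‖V a‖²)/2 ≥ 691/19800`.)  This requires `‖T‖` small — as in the text,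
where `‖T‖ = 10⁻²⁰`. [cite: Enflo2023, v2 p.22, (47)] -/
theorem ex_etheta_ge [CompleteSpace H] (T : H →L[ℂ] H) (hT : ‖T‖ < 1) (hT' : ‖T‖ ≤ 1 / 10) {x₀ : H}
    (hx₀ : ‖x₀‖ = 1) {s : ℕ → H} (hs1 : ∀ n, ‖s n‖ = 1) (hs0 : ∀ n, ⟪x₀, s n⟫_ℂ = 0)
    (n : ℕ) {r : ℝ} (hr : 3 / 10 ≤ r) (hr' : r ≤ 2 / 5) {a : Vy.ℓ2}
    (ha : IsMinimal (Vy.V T hT (exY x₀ + ((1 / 5 : ℝ) : ℂ) • rogue x₀ s n)) x₀ r a) :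
    3 / 100 ≤ re ⟪x₀ - Vy.V T hT (exY x₀ + ((1 / 5 : ℝ) : ℂ) • rogue x₀ s n) a,
      Vy.V T hT (exY x₀ + ((1 / 5 : ℝ) : ℂ) • rogue x₀ s n) a⟫_ℂ := by
  set w : H := exY x₀ + ((1 / 5 : ℝ) : ℂ) • rogue x₀ s n with hw_def
  have hfeas : ‖x₀ - Vy.V T hT w a‖ ≤ r := ha.norm_sub_le
  rcases Nat.eq_zero_or_pos n with rfl | hn
  · -- rogue index: the data vector is `0`, nothing is feasible at radius `r < 1`
    exfalso
    have hV0 : Vy.V T hT w a = 0 := by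
      rw [hw_def, exY_add_rogue_zero, Vy.V_apply]
      simp
    rw [hV0, sub_zero, hx₀] at hfeas
    linarith
  · have hwn : w = ((17 / 20 : ℝ) : ℂ) • x₀ + ((1 / 5 : ℝ) : ℂ) • s n := by
      rw [hw_def, rogue_of_ne_zero x₀ s hn.ne', exY]
    -- the identity move `e₀` is feasible, so `‖a‖ ≤ 1`
    have he₀ : lp.single 2 0 (1 : ℂ) ∈ feasible (Vy.V T hT w) x₀ r := by
      rw [mem_feasible, Vy.V_single, pow_zero, one_apply_eq_self, norm_sub_rev]
      have h1 : w - x₀ = ((-(3 / 20) : ℝ) : ℂ) • x₀ + ((1 / 5 : ℝ) : ℂ) • s n := by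
        have h2 : ((-(3 / 20) : ℝ) : ℂ) = ((17 / 20 : ℝ) : ℂ) - 1 := by
          push_cast
          norm_num
        rw [hwn, h2, sub_smul, one_smul]
        abel
      have h3 : ‖w - x₀‖ ^ 2 ≤ r ^ 2 := by
        rw [h1, norm_sq_combo hx₀ (hs1 n) (hs0 n)]
        have h4 : (3 / 10 : ℝ) ^ 2 ≤ r ^ 2 := pow_le_pow_left₀ (by norm_num) hr 2
        norm_num at h4 ⊢
        linarith
      exact (pow_le_pow_iff_left₀ (norm_nonneg _) (by linarith) two_ne_zero).1 h3
    have ha1 : ‖a‖ ≤ 1 := by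
      have h := ha.norm_le he₀
      rwa [lp.norm_single (by norm_num), norm_one] at h
    -- `‖V_w a‖² ≤ ‖w‖²/(1 − ‖T‖²) ≤ (305/400)(100/99)`
    have hw2 : ‖w‖ ^ 2 = 305 / 400 := by
      rw [hwn, norm_sq_combo hx₀ (hs1 n) (hs0 n)]
      norm_num
    have hκ2 : Real.sqrt (1 / (1 - ‖T‖ ^ 2)) ^ 2 ≤ 100 / 99 := by
      have hT2 : ‖T‖ ^ 2 ≤ (1 / 10) ^ 2 := pow_le_pow_left₀ (norm_nonneg _) hT' 2
      norm_num at hT2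
      have h1 : 0 < 1 - ‖T‖ ^ 2 := by linarith
      rw [Real.sq_sqrt (div_pos one_pos h1).le]
      calc 1 / (1 - ‖T‖ ^ 2) ≤ 1 / (99 / 100) := one_div_le_one_div_of_le (by norm_num) (by linarith)
        _ = 100 / 99 := by norm_num
    have hVa : ‖Vy.V T hT w a‖ ^ 2 ≤ 305 / 400 * (100 / 99) := by
      have hκ0 : 0 ≤ Real.sqrt (1 / (1 - ‖T‖ ^ 2)) := Real.sqrt_nonneg _
      have h1 : ‖Vy.V T hT w a‖ ≤ ‖w‖ * Real.sqrt (1 / (1 - ‖T‖ ^ 2)) * ‖a‖ :=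
        (Vy.V T hT w).le_of_opNorm_le (Vy.norm_V_le T hT w) a
      have h2 : ‖Vy.V T hT w a‖ ≤ ‖w‖ * Real.sqrt (1 / (1 - ‖T‖ ^ 2)) :=
        h1.trans (mul_le_of_le_one_right (mul_nonneg (norm_nonneg _) hκ0) ha1)
      calc ‖Vy.V T hT w a‖ ^ 2 ≤ (‖w‖ * Real.sqrt (1 / (1 - ‖T‖ ^ 2))) ^ 2 :=
            pow_le_pow_left₀ (norm_nonneg _) h2 2
        _ = ‖w‖ ^ 2 * Real.sqrt (1 / (1 - ‖T‖ ^ 2)) ^ 2 := mul_pow _ _ 2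
        _ ≤ 305 / 400 * (100 / 99) := by
            rw [hw2]
            exact mul_le_mul_of_nonneg_left hκ2 (by norm_num)
    have h := etheta_ge_of_norm_sub_le hx₀ hfeas
    have hr2 : r ^ 2 ≤ (2 / 5) ^ 2 := pow_le_pow_left₀ (by linarith) hr' 2
    norm_num at hr2
    linarith

/-- **(47) as printed does not follow** (v2 pp.20–22, STEPS B30): with `M(L)` quantified over ALL `n`
(`MovesBounded`, the printed wording), the hypotheses of (47) — the threshold `L₀` with `Good(L)` below and `¬Good`
at and just above `L₀`, here `L₀ = 1/5` exactly and `M(L₀) = ∞` — are satisfied by the example, while its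
conclusion fails: for `c = 3/100` and every `δ ≤ 1/10` there is NO index `n`, NO radius `r ∈ [0.3, 0.3 + δ]` and NO
minimal move of `y + L₀ s'_n` into the `r`-ball at `x₀` with `(εθ) < c`.  The failing sentence is "Now, if
`M(L₀) = ∞` then, for some `n`, … may require an arbitrarily large `‖ℓ(T)‖₂`.  So, for moving `y₀ + L₀ s_n` by
minimal `ℓ(T)`'s between the distances `0.3 + δ` and `0.3` to `x₀`, may require arbitrarily small `(εθ)`'s."  The
repair (`MovesBoundedEv`, `eq47`) is the eventual-in-`n` threshold, which is what the sequel's "`(εθ)_n` tending to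
`0`" uses. [cite: Enflo2023, v2 p.22, (47); refuted as printed] -/
theorem printed_eq47_fails [CompleteSpace H] (T : H →L[ℂ] H) (hT : ‖T‖ < 1) (hT' : ‖T‖ ≤ 1 / 10)
    {x₀ : H} (hx₀ : ‖x₀‖ = 1) {s : ℕ → H} (hs1 : ∀ n, ‖s n‖ = 1) (hs0 : ∀ n, ⟪x₀, s n⟫_ℂ = 0) :
    ((∀ L, 0 < L → L < 1 / 5 → MovesBounded T hT x₀ (exY x₀) (rogue x₀ s) L) ∧
      ∀ δ > 0, ∃ L, 1 / 5 ≤ L ∧ L < 1 / 5 + δ ∧ 0 < L ∧ ¬ MovesBounded T hT x₀ (exY x₀) (rogue x₀ s) L) ∧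
    (∀ L₀ : ℝ, (∀ L, 0 < L → L < L₀ → MovesBounded T hT x₀ (exY x₀) (rogue x₀ s) L) →
      (∀ δ > 0, ∃ L, L₀ ≤ L ∧ L < L₀ + δ ∧ 0 < L ∧ ¬ MovesBounded T hT x₀ (exY x₀) (rogue x₀ s) L) →
      L₀ = 1 / 5) ∧
    ¬ MovesBounded T hT x₀ (exY x₀) (rogue x₀ s) (1 / 5) ∧
    ¬ (∀ c > 0, ∀ δ > 0, ∀ N : ℕ, ∃ n, N ≤ n ∧ ∃ r : ℝ, 3 / 10 ≤ r ∧ r ≤ 3 / 10 + δ ∧ ∃ a : Vy.ℓ2,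
        IsMinimal (Vy.V T hT (exY x₀ + ((1 / 5 : ℝ) : ℂ) • rogue x₀ s n)) x₀ r a ∧
        0 ≤ re ⟪x₀ - Vy.V T hT (exY x₀ + ((1 / 5 : ℝ) : ℂ) • rogue x₀ s n) a,
          Vy.V T hT (exY x₀ + ((1 / 5 : ℝ) : ℂ) • rogue x₀ s n) a⟫_ℂ ∧
        re ⟪x₀ - Vy.V T hT (exY x₀ + ((1 / 5 : ℝ) : ℂ) • rogue x₀ s n) a,
          Vy.V T hT (exY x₀ + ((1 / 5 : ℝ) : ℂ) • rogue x₀ s n) a⟫_ℂ < c) ∧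
    ∀ (n : ℕ) (r : ℝ) (a : Vy.ℓ2), 3 / 10 ≤ r → r ≤ 2 / 5 →
      IsMinimal (Vy.V T hT (exY x₀ + ((1 / 5 : ℝ) : ℂ) • rogue x₀ s n)) x₀ r a →
      3 / 100 ≤ re ⟪x₀ - Vy.V T hT (exY x₀ + ((1 / 5 : ℝ) : ℂ) • rogue x₀ s n) a,
        Vy.V T hT (exY x₀ + ((1 / 5 : ℝ) : ℂ) • rogue x₀ s n) a⟫_ℂ := by
  obtain ⟨hthr, huniq⟩ := ex_threshold T hT hx₀ hs1 hs0
  refine ⟨hthr, huniq, ex_not_movesBounded T hT hx₀ s, fun h47 => ?_,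
    fun n r a hr hr' ha => ex_etheta_ge T hT hT' hx₀ hs1 hs0 n hr hr' ha⟩
  obtain ⟨n, -, r, hr, hr', a, ha, -, hlt⟩ := h47 (3 / 100) (by norm_num) (1 / 10) (by norm_num) 0
  have hge := ex_etheta_ge T hT hT' hx₀ hs1 hs0 n hr (by linarith) ha
  linarith


end Type2

end Literature.Analysis.OperatorTheory.Enflo2023
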